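import Literature.MathematicalPhysics.QuantumLattice.KomaPiFluxPrintedLongRangeOrder
import Literature.MathematicalPhysics.QuantumLattice.FinDimSpectrumGibbsLimitProofs
import HarnessLib

/-!
# Koma 2022, Theorem 2.1 at zero temperature: the finite-volume ground states (2.13) of the `π`-flux
# BCS lattice fermions have superconducting long-range order, uniformly in the volume

T. Koma, *Nambu–Goldstone modes for superconducting lattice fermions*, arXiv:2201.13135 (2022)
[Koma2022], (2.13): "The ground state in the finite volume is given by
`ω^{(Λ)}_{B,g'}(⋯) := lim_{β↗∞} ⟨⋯⟩^{(Λ)}_{β,B}`", and Theorem 2.1 (`m_LRO > 0` for all `β ≥ β_c`). Since the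
volume threshold `k₀` of `KomaPiFlux.superconductingOrder` / `printed_superconductingOrder` does not
depend on `β`, the bound passes to the zero-temperature limit (2.13) on every fixed torus (the tree's
`Matrix.tendsto_gibbsState_atTop_holds`: `⟨A⟩_β → tr(P₀A)/tr P₀`, the tracial ground state):

* `groundLroSq H = |Λ|⁻²Σ_{x,y} Re ω_GS(Γ¹_xΓ¹_y)` — the order parameter `m²` in the tracial ground state
  `ω_GS = Matrix.groundStateFunctional H` (the limit (2.13) at `B = 0`); `tendsto_lroSq_atTop`:
  `lroSq β H → groundLroSq H` as `β → ∞` for Hermitian `H`;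
* **`groundState_superconductingOrder`** (Lieb frame): `D = d + 1 ≥ 3`, `g > 0`, `|κ| ≤ g/1000`,
  `U + 2gD ≤ 0` ⟹ `groundLroSq H₀ ≥ 1/2000` on every torus of side `2k`, `k ≥ k₀`;
* **`printed_groundState_superconductingOrder`**: for the printed Hamiltonian (2.4)–(2.9) and the staggered
  `O` of (2.5), the zero-temperature limit of Koma's `m^{(Λ)}_LRO` ((2.11), `KomaPiFlux.mLRO`) exists and
  is `≥ 1/50` on every torus of side `2k ≥ 2k₀` (`|κ| ≤ g/1000`).

No named fact; one definition (`groundLroSq`, with body).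

## References

* [Koma2022] T. Koma, arXiv:2201.13135, (2.11)–(2.13), Theorem 2.1.
* [Tasaki2020] H. Tasaki, *Physics and Mathematics of Quantum Many-Body Systems*, Springer 2020, App. A
  (the `β → ∞` limit of Gibbs states).
-/

noncomputable section

namespace Literature.MathematicalPhysics.QuantumLattice

open Matrix Finset Filter Topology HubbardWave0 PairHopRP FermionTorus LiebCutRP

namespace KomaPiFlux

attribute [local instance] LiebCutRP.decEqTorus

variable {d L : ℕ} [NeZero L]

/-- **The order parameter in the tracial ground state**: `|Λ|⁻²Σ_{x,y} Re ω_GS(Γ¹_xΓ¹_y)`,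
`ω_GS(A) = tr(P₀A)/tr P₀` (the zero-temperature limit (2.13) of `lroSq`). [cite: Koma2022, (2.13), (6.18)] -/
def groundLroSq (H : Matrix (Finset (Orb (FermionTorus (d + 1) L))) (Finset (Orb (FermionTorus (d + 1) L))) ℂ) : ℝ :=
  (∑ x : FermionTorus (d + 1) L, ∑ y : FermionTorus (d + 1) L, (H.groundStateFunctional (gammaOne x * gammaOne y)).re) /
    (Fintype.card (FermionTorus (d + 1) L) : ℝ) ^ 2

omit [NeZero L] in
/-- **`lroSq β H → groundLroSq H` as `β → ∞`** (Hermitian `H`; the Gibbs state converges to the tracial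
ground state). [cite: Koma2022, (2.13)] [cite: Tasaki2020, App. A] -/
theorem tendsto_lroSq_atTop {H : Matrix (Finset (Orb (FermionTorus (d + 1) L))) (Finset (Orb (FermionTorus (d + 1) L))) ℂ}
    (hH : H.IsHermitian) : Tendsto (fun β : ℝ => lroSq β H) atTop (𝓝 (groundLroSq H)) := by
  unfold lroSq groundLroSq pairCorr
  refine Tendsto.div_const (tendsto_finsetSum _ fun x _ => tendsto_finsetSum _ fun y _ => ?_) _
  exact (Complex.continuous_re.tendsto _).comp (Matrix.tendsto_gibbsState_atTop_holds hH _)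

/-- **Theorem 2.1 in the finite-volume ground states (Lieb frame).** In `D = d + 1 ≥ 3` directions, for
`g > 0`, `|κ| ≤ g/1000` and `U + 2g(d+1) ≤ 0` there is `k₀` such that on every torus of side `2k`, `k ≥ k₀`,
the tracial ground state of `H₀ = H(κ, U, g; 0, 0)` has `|Λ|⁻²Σ_{x,y}Re ω_GS(Γ¹_xΓ¹_y) ≥ 1/2000`.
[cite: Koma2022, Theorem 2.1, (2.13)] -/
theorem groundState_superconductingOrder (hd : 2 ≤ d) {κ U g : ℝ} (hg : 0 < g) (hκg : |κ| ≤ g / 1000)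
    (hU : U + 2 * g * (d + 1) ≤ 0) :
    ∃ k₀ : ℕ, ∀ k : ℕ, k₀ ≤ k → ∀ [NeZero (2 * k)],
      (1 / 2000 : ℝ) ≤ groundLroSq (hamiltonian κ U g (fun (_ _ : FermionTorus (d + 1) (2 * k)) => (0 : ℝ)) 0) := by
  obtain ⟨β₀, k₀, -, h⟩ := superconductingOrder_abs hd hg hκg hU
  refine ⟨k₀, fun k hk _ => ?_⟩
  have hH : (hamiltonian κ U g (fun (_ _ : FermionTorus (d + 1) (2 * k)) => (0 : ℝ)) 0).IsHermitian :=
    hamiltonian_isHermitian (G d (2 * k)) (piFluxAmpl κ) (piFluxAmpl_herm κ) U g _ 0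
  exact ge_of_tendsto (tendsto_lroSq_atTop hH)
    ((eventually_ge_atTop β₀).mono fun β hβ => h β hβ k hk)

/-- **The zero-temperature limit of Koma's `m^{(Λ)}_LRO` exists**: `mLRO β κ g → √(groundLroSq H₀)`,
`H₀ = H_Lieb(κ, -2Dg, g)` (even side `L ≥ 4`). [cite: Koma2022, (2.11), (2.13)] -/
theorem tendsto_mLRO_atTop (hL : Even L) (h4 : 4 ≤ L) (κ g : ℝ) :
    Tendsto (fun β : ℝ => mLRO (d := d) (L := L) β κ g) atTop
      (𝓝 (Real.sqrt (groundLroSq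
        (hamiltonian κ (-2 * (d + 1 : ℕ) * g) g (fun (_ _ : FermionTorus (d + 1) L) => (0 : ℝ)) 0)))) := by
  have hH : (hamiltonian κ (-2 * (d + 1 : ℕ) * g) g (fun (_ _ : FermionTorus (d + 1) L) => (0 : ℝ)) 0).IsHermitian :=
    hamiltonian_isHermitian (G d L) (piFluxAmpl κ) (piFluxAmpl_herm κ) _ g _ 0
  have h := (Real.continuous_sqrt.tendsto _).comp (tendsto_lroSq_atTop hH)
  refine h.congr' (Eventually.of_forall fun β => ?_)
  simp only [Function.comp_apply, mLRO_eq_sqrt_lroSq hL h4]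

/-- **Theorem 2.1 for the finite-volume ground states (2.13) of the printed model.** In `D = d + 1 ≥ 3`
directions, for `g > 0` and `|κ| ≤ g/1000` there is `k₀` such that on every torus of side `2k`, `k ≥ k₀`, the
zero-temperature limit `lim_{β→∞} m^{(Λ)}_LRO` of Koma's order parameter (2.11) for the printed Hamiltonian
(2.4)–(2.9) exists and is at least `1/50`. [cite: Koma2022, Theorem 2.1, (2.11)–(2.13)] -/
theorem printed_groundState_superconductingOrder (hd : 2 ≤ d) {κ g : ℝ} (hg : 0 < g) (hκg : |κ| ≤ g / 1000) :
    ∃ k₀ : ℕ, ∀ k : ℕ, k₀ ≤ k → ∀ [NeZero (2 * k)], ∃ m₀ : ℝ, (1 / 50 : ℝ) ≤ m₀ ∧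
      Tendsto (fun β : ℝ => mLRO (d := d) (L := 2 * k) β κ g) atTop (𝓝 m₀) := by
  have hU : (-2 * (d + 1 : ℕ) * g : ℝ) + 2 * g * (d + 1) ≤ 0 := by push_cast; linarith
  obtain ⟨k₀, h⟩ := groundState_superconductingOrder hd hg hκg hU
  refine ⟨max k₀ 2, fun k hk _ => ⟨_, ?_, tendsto_mLRO_atTop (even_two_mul k) (by omega) κ g⟩⟩
  have h' := h k (le_trans (le_max_left _ _) hk)
  calc (1 / 50 : ℝ) = Real.sqrt ((1 / 50) ^ 2) := (Real.sqrt_sq (by norm_num)).symm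
    _ ≤ Real.sqrt (1 / 2000) := Real.sqrt_le_sqrt (by norm_num)
    _ ≤ _ := Real.sqrt_le_sqrt h'

end KomaPiFlux

end Literature.MathematicalPhysics.QuantumLattice

end
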